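import Summits.BirchSwinnertonDyer.BirchSwinnertonDyer.Theorems.AlignedTransportAtTwoMainConjectureOfRankZeroBSDAtTwoCubicChevalleyRowN1763ClassNumber
import Literature.NumberTheory.CubicFields.CubicFieldDiscriminant13523ClassNumber
import Literature.NumberTheory.CubicFields.CubicFieldDiscriminant14539ClassNumber
import HarnessLib

/-!
# Route `AlignedTransportAtTwo`, crux C2 `MainConjectureOfRankZeroBSDAtTwo` (stmt-BirchSwinnertonDyer-22298):
# CLASS NUMBER ONE IV (G) — THE DOORS-DEAD SUB-CELL: `h(ℚ(β)) = 1` IN THE KERNEL for `[1,0,0,-33,-76]` (`N = 13523`), `[1,1,1,-11,-20]` (`N = 14539`)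

HONEST FRAMING (cell `bsd-f1-sign2`, WIDTH-5 attached prover seat `bsd-line-att-p4` gen 38 on line `birth` of the lead `bsd-line-att-p2`;
`--supports` stmt-BirchSwinnertonDyer-22298, closes nothing; BSD is NOT proved by any of this; the crux C2, its verdict «blocked-on
`Rank1Residual.GreenbergMuConjectureIrreducible`» and every registered stub (P/T/Kμ/LimDoor/MuIneqʳ/PFμ⁺ of `Lines/birth.lean` v9) are untouched).
THEOREMS ONLY (no `def`, no named fact, no instance, no `sorry`); every curve is written LITERALLY; no Cremona label is asserted (names use `n<conductor>`).

WHAT.  The sub-cell `Δ_min ≡ 5 (mod 8)`, `σ₁(ε) ≡ ±1 (mod 8)` (classes u1/u7 of att-p5 g31's / att-p3 g41's ODDBRANCH census) is where the cubic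
Chevalley unit-sign doors of the road are DEAD; every remaining door of the cell (att-p3 g41 layer-one unit door, g42 depth door, g43 genus-character
certificate) displays the datum «`h(ℚ(β))` odd» resp. «`h(ℚ(β)) = 1`», and g41 §census / g42 §3 filed the CENSUS ASK «what is `h(ℚ(β))` on this
sub-cell?» to att-p4 / -data.  This file answers it IN THE KERNEL for the curves above: for each, `θ = (x + y·u + z·u²)/16 ∈ ℚ(β)` (`u = 4β`) is a root
of a monic integer cubic `f` of (squarefree) discriminant `−N` (`aeval_theta_n<N>`, ONE `linear_combination` against `ψ_W(β) = 0`), so `ℚ(β)` is a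
model of the cubic field of discriminant `−N` (LMFDB 3.1.N.1 — the ONLY cubic field of that discriminant, `Cl(ℚ(√−N))` having `3`-rank `1`), whose
class number is ONE by this seat's tree theorems `Literature.NumberTheory.CubicFields.CubicDisc<N>.classNumber_eq_one` (`𝓞 = ℤ[θ]`, Minkowski bound,
every prime below it principal with an explicit generator; g27's template).  Per curve: `Δ`, `c₄`, ellipticity, global minimality, `#Ẽ(𝔽₂) = 4`
(`a₂ = −1`, good ORDINARY at `2`), `b₂,b₄,b₆`, `E[2]` irreducible (no rational `2`-torsion abscissa), `Δ_min ≡ 5 (mod 8)`, `Δ < 0`, then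
★ `classNumber_cubicField_n<N>_eq_one`, ★ `not_two_dvd_classNumber_cubicField_n<N>` (the doors' datum VERBATIM) and `discr_cubicField_n<N>`.
What this is NOT: no `μ`-invariant is computed here (on this sub-cell the unit-sign door does not fire and the layer-one / depth doors need further
certificates — g41: `e₁ ≥ 2` for `−1187`, `−1259`, `−4307`; `−3027` and `−3523` are layer-one-door CANDIDATES of class `σ₁(ε) ≡ ±7 (mod 16)` whose `h`
was unknown («h > 1 suspected») and is now `1`); nothing is asserted about BSD or `MC₂` for these curves.  Companion DATA (pure python, seat memo
`Cruxes/MainConjectureOfRankZeroBSDAtTwo/CLASS-NUMBER-ONE-IV-att-p4-g38.md`): on `N < 6000` the u1/u7 rows `−643, −1099, −1963, −2051, −2843, −2859,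
−3891, −4979, −5963` have EVEN class number (outside every h-odd door), `−1187, −1259, −3027, −3523, −4307, −4827, −5747` have `h = 1` (siblings A–D);
files E–H extend the kernel census to the rank-0 u1/u7 seeds `6000 < N < 15000` with a monogenic model found: `−6555`, `−9139` (E), `−12163`, `−13283` (F),
`−13523`, `−14539` (G), `−14891` (H).

References: [LMFDB] number fields 3.1.N.1 (class number 1); [Marcus2018] Ch. 5 Thm. 37; [SilvermanAEC2009] III.1, III.2.3, VII.1, VII.5;
[Serre1973] II §3.3; tree: att-p5 g31/g32 `…CubicChevalleyRow*`, att-p4 g27/g28 `…Row*ClassNumber`, `Literature/NumberTheory/CubicFields/CubicFieldDiscriminant<N>ClassNumber`.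
-/

set_option linter.dupNamespace false
set_option autoImplicit false

noncomputable section

open scoped Classical NumberField nonZeroDivisors IntermediateField

namespace Summit.BirchSwinnertonDyer.BirchSwinnertonDyer.Theorems.AlignedTransportAtTwoCubicDoorsDeadSubcellClassNumberG

open NumberField IsDedekindDomain Polynomial WeierstrassCurve IntermediateField CongruenceSubgroup Module
  Literature.NumberTheory.IwasawaTheory Literature.NumberTheory.GaloisRepresentations
  Literature.NumberTheory.EllipticCurves Literature.NumberTheory.EllipticCurves.Greenberg1999
  Literature.NumberTheory.EllipticCurves.ModularForms Literature.NumberTheory.EllipticCurves.Rank1Residual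
  Literature.NumberTheory.EllipticCurves.Module
  Literature.NumberTheory.NumberFields Literature.NumberTheory.CubicFields
  Summit.BirchSwinnertonDyer.Rank1Residual Summit.BirchSwinnertonDyer.Rank1Residual.X1.MuLambda
  Summit.BirchSwinnertonDyer.Rank1Residual.X5 Summit.BirchSwinnertonDyer.Rank1Residual.X5.O1
  Summit.BirchSwinnertonDyer.Rank1Residual.X5.Instances Summit.BirchSwinnertonDyer.Rank1Residual.F1Sign2
  Summit.BirchSwinnertonDyer.BirchSwinnertonDyer.Theorems.Rank1ResidualX1Defs
  Summit.BirchSwinnertonDyer.BirchSwinnertonDyer.Theses.AlignedTransportAtTwo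
open Summit.BirchSwinnertonDyer.BirchSwinnertonDyer.Theorems.AlignedTransportAtTwoCubicKilfordPrimes (psi_gen_eq_zero)

/-! ## The curve `[1, 0, 0, -33, -76]` of conductor `13523` (prime)` (rank 0, `L/Ω = 1`) — kernel-decided invariants and `h(ℚ(β)) = 1` -/

/-- `Δ = −13523`. [cite: SilvermanAEC2009, III.1] -/
theorem M13523_Δ : (⟨1, 0, 0, -33, -76⟩ : WeierstrassCurve ℤ).Δ = -13523 := by decide

/-- `c₄ = 1585`. [cite: SilvermanAEC2009, III.1] -/
theorem M13523_c₄ : (⟨1, 0, 0, -33, -76⟩ : WeierstrassCurve ℤ).c₄ = 1585 := by decide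

/-- `[1,0,0,-33,-76]` is an elliptic curve (`Δ = −13523 ≠ 0`). [cite: SilvermanAEC2009, III.1] -/
theorem isElliptic_n13523 : ((⟨1, 0, 0, -33, -76⟩ : WeierstrassCurve ℤ).baseChange ℚ).IsElliptic := by
  rw [WeierstrassCurve.isElliptic_iff, baseChange_int_Δ, M13523_Δ]; norm_num

/-- The model `[1,0,0,-33,-76]` is globally minimal (`gcd(Δ, c₄) = 1`). [cite: SilvermanAEC2009, VII.1 Remark 1.1] -/
theorem isGloballyMinimal_n13523 : ((⟨1, 0, 0, -33, -76⟩ : WeierstrassCurve ℤ).baseChange ℚ).IsGloballyMinimal :=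
  isGloballyMinimal_baseChange_int_of_gcd_eq_one 1 (0) 0 (-33) (-76) (by decide)

/-- `[1,0,0,-33,-76] mod 2` is `[1,0,0,1,0]`. [folklore] -/
theorem M13523_mod_two : (⟨1, 0, 0, -33, -76⟩ : WeierstrassCurve ℤ).map (Int.castRingHom (ZMod 2)) = ⟨1, 0, 0, 1, 0⟩ := by
  ext <;> decide

/-- `#Ẽ(𝔽₂) = 4` for `[1,0,0,-33,-76]` (`a₂ = 3 − 4 = -1`). [cite: SilvermanAEC2009, V.2] -/
theorem M13523_card_two :
    Nat.card ((⟨1, 0, 0, -33, -76⟩ : WeierstrassCurve ℤ).map (Int.castRingHom (ZMod 2))).toAffine.Point = 4 := by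
  rw [M13523_mod_two, natCard_point_eq_one_add_card _ (by decide)]; decide

/-- **`[1,0,0,-33,-76]` has good ORDINARY reduction at `2`** (`2 ∤ Δ`, `#Ẽ(𝔽₂) = 4`, `a₂ = -1` odd). [cite: SilvermanAEC2009, VII.5 Prop. 5.1 (a)] -/
theorem goodOrd_two_n13523 [((⟨1, 0, 0, -33, -76⟩ : WeierstrassCurve ℤ).baseChange ℚ).IsElliptic] [((⟨1, 0, 0, -33, -76⟩ : WeierstrassCurve ℤ).baseChange ℚ).IsGloballyMinimal] :
    GoodOrd ((⟨1, 0, 0, -33, -76⟩ : WeierstrassCurve ℤ).baseChange ℚ) 2 :=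
  Instances.goodOrd_two_baseChange_int _ (by rw [M13523_Δ]; decide) M13523_card_two

/-- The coefficients of `[1,0,0,-33,-76] / ℚ` (unfolded). [cite: SilvermanAEC2009, III.1] -/
theorem c13523_eq : ((⟨1, 0, 0, -33, -76⟩ : WeierstrassCurve ℤ).baseChange ℚ) = ⟨1, 0, 0, -33, -76⟩ := by
  rw [baseChange_int_eq]; norm_num

/-- `b₂, b₄, b₆` of `[1,0,0,-33,-76]`: `1, -66, -304`. [cite: SilvermanAEC2009, III.1] -/
theorem c13523_b : ((⟨1, 0, 0, -33, -76⟩ : WeierstrassCurve ℤ).baseChange ℚ).b₂ = ((1 : ℤ) : ℚ) ∧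
    ((⟨1, 0, 0, -33, -76⟩ : WeierstrassCurve ℤ).baseChange ℚ).b₄ = ((-66 : ℤ) : ℚ) ∧
    ((⟨1, 0, 0, -33, -76⟩ : WeierstrassCurve ℤ).baseChange ℚ).b₆ = ((-304 : ℤ) : ℚ) := by
  rw [c13523_eq]; simp only [WeierstrassCurve.b₂, WeierstrassCurve.b₄, WeierstrassCurve.b₆]; norm_num

/-- **`E[2]` irreducible for `[1,0,0,-33,-76]`**: the monic `u`-cubic `u³ + 1u² − 528u − 4864` has no root modulo `3`.
[cite: SilvermanAEC2009, III.2.3 (b)] -/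
theorem irr_two_n13523 [((⟨1, 0, 0, -33, -76⟩ : WeierstrassCurve ℤ).baseChange ℚ).IsElliptic] : Irr ((⟨1, 0, 0, -33, -76⟩ : WeierstrassCurve ℤ).baseChange ℚ) 2 :=
  irr_two_of_forall_cubic_ne _ c13523_b.1 c13523_b.2.1 c13523_b.2.2 (ℓ := 3) (by decide)

/-- No rational `2`-torsion abscissa on `[1,0,0,-33,-76]` (the route's `ht` binder). [cite: SilvermanAEC2009, III.2.3 (b)] -/
theorem not_hasRationalTwoTorsionX_n13523 [((⟨1, 0, 0, -33, -76⟩ : WeierstrassCurve ℤ).baseChange ℚ).IsElliptic] :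
    ∀ x : ℚ, ¬ HasRationalTwoTorsionX ((⟨1, 0, 0, -33, -76⟩ : WeierstrassCurve ℤ).baseChange ℚ) x := by
  intro x hx
  exact (O1.irr_two_iff_not_exists_addOrderOf_eq_two _).mp irr_two_n13523 (exists_point_addOrderOf_eq_two hx)

/-- `Δ_min = −13523`. [cite: SilvermanAEC2009, VII.1] -/
theorem minimalDiscriminantInt_n13523 [((⟨1, 0, 0, -33, -76⟩ : WeierstrassCurve ℤ).baseChange ℚ).IsGloballyMinimal] :
    ((⟨1, 0, 0, -33, -76⟩ : WeierstrassCurve ℤ).baseChange ℚ).minimalDiscriminantInt = -13523 := by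
  rw [Instances.minimalDiscriminantInt_baseChange_int, M13523_Δ]

/-- `Δ_min = −13523 ≡ 5 (mod 8)`: the curve is OFF the Kilford stratum (`2 = 𝔭₁𝔭₂` in `ℚ(β)`). [cite: Serre1973, Ch. II §3.3 Thm. 4] -/
theorem minimalDiscriminantInt_emod_eight_n13523 [((⟨1, 0, 0, -33, -76⟩ : WeierstrassCurve ℤ).baseChange ℚ).IsGloballyMinimal] :
    ((⟨1, 0, 0, -33, -76⟩ : WeierstrassCurve ℤ).baseChange ℚ).minimalDiscriminantInt % 8 = 5 := by
  rw [minimalDiscriminantInt_n13523]; decide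

/-- `Δ < 0` (one real root of the `2`-division cubic: `ℚ(β)` is a complex cubic field). [cite: SilvermanAEC2009, III.1] -/
theorem Δ_n13523_neg : ((⟨1, 0, 0, -33, -76⟩ : WeierstrassCurve ℤ).baseChange ℚ).Δ < 0 := by
  rw [baseChange_int_Δ, M13523_Δ]; norm_num

/-- **`θ := (384 + 15u − u²)/16 ∈ ℚ(β)` (`u = 4β`) is a root of `f = X³ − 5X² − X − 14`** (one `linear_combination` against
`ψ_W(β) = 4β³ + 1β² − 132β − 304 = 0`; the multiplier is the exact quotient in `ℚ[β]`).
[cite: LMFDB, number field 3.1.13523.1 (degree 3, discriminant −13523)] [cite: SilvermanAEC2009, III.1] -/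
theorem aeval_theta_n13523 {β : AlgebraicClosure ℚ}
    (hβ : aeval β ((⟨1, 0, 0, -33, -76⟩ : WeierstrassCurve ℤ).baseChange ℚ).twoTorsionPolynomial.toPoly = 0) :
    aeval (-(AdjoinSimple.gen ℚ β : ↥(IntermediateField.adjoin ℚ ({β} : Set (AlgebraicClosure ℚ)))) ^ 2
        + 15 / 4 * (AdjoinSimple.gen ℚ β : ↥(IntermediateField.adjoin ℚ ({β} : Set (AlgebraicClosure ℚ))))
        + 24)
      (MonicCubic.poly (-5) (-1) (-14)) = 0 := by
  have hψ := psi_gen_eq_zero ((⟨1, 0, 0, -33, -76⟩ : WeierstrassCurve ℤ).baseChange ℚ) hβ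
  rw [c13523_b.1, c13523_b.2.1, c13523_b.2.2] at hψ
  set g : ↥(IntermediateField.adjoin ℚ ({β} : Set (AlgebraicClosure ℚ))) := AdjoinSimple.gen ℚ β with hg
  simp only [MonicCubic.poly, map_add, map_mul, map_pow, aeval_X, eq_intCast, map_intCast]
  push_cast at hψ ⊢
  linear_combination ((-1 / 4 : ↥(IntermediateField.adjoin ℚ ({β} : Set (AlgebraicClosure ℚ)))) * g ^ 3
    + (23 / 8 : ↥(IntermediateField.adjoin ℚ ({β} : Set (AlgebraicClosure ℚ)))) * g ^ 2
    + (-177 / 64 : ↥(IntermediateField.adjoin ℚ ({β} : Set (AlgebraicClosure ℚ)))) * g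
    + (-287 / 8 : ↥(IntermediateField.adjoin ℚ ({β} : Set (AlgebraicClosure ℚ))))) * hψ

/-- `[ℚ(β) : ℚ] = 3` (`E[2]` of `[1,0,0,-33,-76]` is irreducible). [cite: SilvermanAEC2009, III.2.3 (b)] -/
theorem finrank_cubicField_n13523 {β : AlgebraicClosure ℚ}
    (hβ : aeval β ((⟨1, 0, 0, -33, -76⟩ : WeierstrassCurve ℤ).baseChange ℚ).twoTorsionPolynomial.toPoly = 0) :
    finrank ℚ ↥(IntermediateField.adjoin ℚ ({β} : Set (AlgebraicClosure ℚ))) = 3 := by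
  haveI := isElliptic_n13523
  exact AddKatoTwo.finrank_adjoin_root_twoTorsionPolynomial_eq_three _
    (AlignedTransportAtTwoSeed.irr_two_of_forall_not_hasRationalTwoTorsionX _ not_hasRationalTwoTorsionX_n13523) hβ

/-- **`d_{ℚ(β)} = −13523`**: `ℚ(β)` is the cubic field of discriminant `−13523` (att-p4's `CubicDisc13523.discr_eq` at the model `θ`).
[cite: LMFDB, number field 3.1.13523.1 (discriminant −13523)] -/
theorem discr_cubicField_n13523 {β : AlgebraicClosure ℚ}
    (hβ : aeval β ((⟨1, 0, 0, -33, -76⟩ : WeierstrassCurve ℤ).baseChange ℚ).twoTorsionPolynomial.toPoly = 0) :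
    (haveI : FiniteDimensional ℚ ↥(IntermediateField.adjoin ℚ ({β} : Set (AlgebraicClosure ℚ))) :=
        IntermediateField.adjoin.finiteDimensional ((AlgebraicClosure.isAlgebraic ℚ).isAlgebraic β).isIntegral;
      haveI : NumberField ↥(IntermediateField.adjoin ℚ ({β} : Set (AlgebraicClosure ℚ))) := NumberField.mk;
      NumberField.discr ↥(IntermediateField.adjoin ℚ ({β} : Set (AlgebraicClosure ℚ))) = -13523) := by
  haveI : FiniteDimensional ℚ ↥(IntermediateField.adjoin ℚ ({β} : Set (AlgebraicClosure ℚ))) :=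
    IntermediateField.adjoin.finiteDimensional ((AlgebraicClosure.isAlgebraic ℚ).isAlgebraic β).isIntegral
  haveI : NumberField ↥(IntermediateField.adjoin ℚ ({β} : Set (AlgebraicClosure ℚ))) := NumberField.mk
  exact CubicDisc13523.discr_eq (finrank_cubicField_n13523 hβ) (aeval_theta_n13523 hβ)

/-- ★ **THE CLASS NUMBER OF `ℚ(β)` IS ONE** (`β` any root in `ℚ̄` of the `2`-division cubic of `[1,0,0,-33,-76]`): `ℚ(β)` is the cubic field of
discriminant `−13523`, and `h = 1` is the tree theorem `CubicDisc13523.classNumber_eq_one` (`𝓞 = ℤ[θ]`, Minkowski bound, every prime below it principal with an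
explicit generator). [cite: LMFDB, number field 3.1.13523.1 (class number 1)] [cite: Marcus2018, Ch. 5, Thm. 37] -/
theorem classNumber_cubicField_n13523_eq_one {β : AlgebraicClosure ℚ}
    (hβ : aeval β ((⟨1, 0, 0, -33, -76⟩ : WeierstrassCurve ℤ).baseChange ℚ).twoTorsionPolynomial.toPoly = 0) :
    (haveI : FiniteDimensional ℚ ↥(IntermediateField.adjoin ℚ ({β} : Set (AlgebraicClosure ℚ))) :=
        IntermediateField.adjoin.finiteDimensional ((AlgebraicClosure.isAlgebraic ℚ).isAlgebraic β).isIntegral;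
      haveI : NumberField ↥(IntermediateField.adjoin ℚ ({β} : Set (AlgebraicClosure ℚ))) := NumberField.mk;
      classNumber ↥(IntermediateField.adjoin ℚ ({β} : Set (AlgebraicClosure ℚ))) = 1) := by
  haveI : FiniteDimensional ℚ ↥(IntermediateField.adjoin ℚ ({β} : Set (AlgebraicClosure ℚ))) :=
    IntermediateField.adjoin.finiteDimensional ((AlgebraicClosure.isAlgebraic ℚ).isAlgebraic β).isIntegral
  haveI : NumberField ↥(IntermediateField.adjoin ℚ ({β} : Set (AlgebraicClosure ℚ))) := NumberField.mk
  exact CubicDisc13523.classNumber_eq_one (finrank_cubicField_n13523 hβ) (aeval_theta_n13523 hβ)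

/-- ★ **`2 ∤ h(ℚ(β))`** — VERBATIM the displayed datum `hh` / `2 ∤ h_K` of the cell's class-group doors (att-p5 g29 Chevalley doors, att-p3 g41 layer-one
unit door, g42 depth door), now a theorem for this curve. [cite: LMFDB, number field 3.1.13523.1 (class number 1)] -/
theorem not_two_dvd_classNumber_cubicField_n13523 {β : AlgebraicClosure ℚ}
    (hβ : aeval β ((⟨1, 0, 0, -33, -76⟩ : WeierstrassCurve ℤ).baseChange ℚ).twoTorsionPolynomial.toPoly = 0) :
    (haveI : FiniteDimensional ℚ ↥(IntermediateField.adjoin ℚ ({β} : Set (AlgebraicClosure ℚ))) :=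
        IntermediateField.adjoin.finiteDimensional ((AlgebraicClosure.isAlgebraic ℚ).isAlgebraic β).isIntegral;
      haveI : NumberField ↥(IntermediateField.adjoin ℚ ({β} : Set (AlgebraicClosure ℚ))) := NumberField.mk;
      ¬ 2 ∣ classNumber ↥(IntermediateField.adjoin ℚ ({β} : Set (AlgebraicClosure ℚ)))) := by
  haveI : FiniteDimensional ℚ ↥(IntermediateField.adjoin ℚ ({β} : Set (AlgebraicClosure ℚ))) :=
    IntermediateField.adjoin.finiteDimensional ((AlgebraicClosure.isAlgebraic ℚ).isAlgebraic β).isIntegral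
  haveI : NumberField ↥(IntermediateField.adjoin ℚ ({β} : Set (AlgebraicClosure ℚ))) := NumberField.mk
  exact CubicDisc13523.not_two_dvd_classNumber (finrank_cubicField_n13523 hβ) (aeval_theta_n13523 hβ)

/-! ## The curve `[1, 1, 1, -11, -20]` of conductor `14539 = 7·31·67`` (rank 0, `L/Ω = 1`) — kernel-decided invariants and `h(ℚ(β)) = 1` -/

/-- `Δ = −14539`. [cite: SilvermanAEC2009, III.1] -/
theorem M14539_Δ : (⟨1, 1, 1, -11, -20⟩ : WeierstrassCurve ℤ).Δ = -14539 := by decide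

/-- `c₄ = 529`. [cite: SilvermanAEC2009, III.1] -/
theorem M14539_c₄ : (⟨1, 1, 1, -11, -20⟩ : WeierstrassCurve ℤ).c₄ = 529 := by decide

/-- `[1,1,1,-11,-20]` is an elliptic curve (`Δ = −14539 ≠ 0`). [cite: SilvermanAEC2009, III.1] -/
theorem isElliptic_n14539 : ((⟨1, 1, 1, -11, -20⟩ : WeierstrassCurve ℤ).baseChange ℚ).IsElliptic := by
  rw [WeierstrassCurve.isElliptic_iff, baseChange_int_Δ, M14539_Δ]; norm_num

/-- The model `[1,1,1,-11,-20]` is globally minimal (`gcd(Δ, c₄) = 1`). [cite: SilvermanAEC2009, VII.1 Remark 1.1] -/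
theorem isGloballyMinimal_n14539 : ((⟨1, 1, 1, -11, -20⟩ : WeierstrassCurve ℤ).baseChange ℚ).IsGloballyMinimal :=
  isGloballyMinimal_baseChange_int_of_gcd_eq_one 1 (1) 1 (-11) (-20) (by decide)

/-- `[1,1,1,-11,-20] mod 2` is `[1,1,1,1,0]`. [folklore] -/
theorem M14539_mod_two : (⟨1, 1, 1, -11, -20⟩ : WeierstrassCurve ℤ).map (Int.castRingHom (ZMod 2)) = ⟨1, 1, 1, 1, 0⟩ := by
  ext <;> decide

/-- `#Ẽ(𝔽₂) = 4` for `[1,1,1,-11,-20]` (`a₂ = 3 − 4 = -1`). [cite: SilvermanAEC2009, V.2] -/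
theorem M14539_card_two :
    Nat.card ((⟨1, 1, 1, -11, -20⟩ : WeierstrassCurve ℤ).map (Int.castRingHom (ZMod 2))).toAffine.Point = 4 := by
  rw [M14539_mod_two, natCard_point_eq_one_add_card _ (by decide)]; decide

/-- **`[1,1,1,-11,-20]` has good ORDINARY reduction at `2`** (`2 ∤ Δ`, `#Ẽ(𝔽₂) = 4`, `a₂ = -1` odd). [cite: SilvermanAEC2009, VII.5 Prop. 5.1 (a)] -/
theorem goodOrd_two_n14539 [((⟨1, 1, 1, -11, -20⟩ : WeierstrassCurve ℤ).baseChange ℚ).IsElliptic] [((⟨1, 1, 1, -11, -20⟩ : WeierstrassCurve ℤ).baseChange ℚ).IsGloballyMinimal] :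
    GoodOrd ((⟨1, 1, 1, -11, -20⟩ : WeierstrassCurve ℤ).baseChange ℚ) 2 :=
  Instances.goodOrd_two_baseChange_int _ (by rw [M14539_Δ]; decide) M14539_card_two

/-- The coefficients of `[1,1,1,-11,-20] / ℚ` (unfolded). [cite: SilvermanAEC2009, III.1] -/
theorem c14539_eq : ((⟨1, 1, 1, -11, -20⟩ : WeierstrassCurve ℤ).baseChange ℚ) = ⟨1, 1, 1, -11, -20⟩ := by
  rw [baseChange_int_eq]; norm_num

/-- `b₂, b₄, b₆` of `[1,1,1,-11,-20]`: `5, -21, -79`. [cite: SilvermanAEC2009, III.1] -/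
theorem c14539_b : ((⟨1, 1, 1, -11, -20⟩ : WeierstrassCurve ℤ).baseChange ℚ).b₂ = ((5 : ℤ) : ℚ) ∧
    ((⟨1, 1, 1, -11, -20⟩ : WeierstrassCurve ℤ).baseChange ℚ).b₄ = ((-21 : ℤ) : ℚ) ∧
    ((⟨1, 1, 1, -11, -20⟩ : WeierstrassCurve ℤ).baseChange ℚ).b₆ = ((-79 : ℤ) : ℚ) := by
  rw [c14539_eq]; simp only [WeierstrassCurve.b₂, WeierstrassCurve.b₄, WeierstrassCurve.b₆]; norm_num

/-- **`E[2]` irreducible for `[1,1,1,-11,-20]`**: the monic `u`-cubic `u³ + 5u² − 168u − 1264` has no root modulo `5`.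
[cite: SilvermanAEC2009, III.2.3 (b)] -/
theorem irr_two_n14539 [((⟨1, 1, 1, -11, -20⟩ : WeierstrassCurve ℤ).baseChange ℚ).IsElliptic] : Irr ((⟨1, 1, 1, -11, -20⟩ : WeierstrassCurve ℤ).baseChange ℚ) 2 :=
  irr_two_of_forall_cubic_ne _ c14539_b.1 c14539_b.2.1 c14539_b.2.2 (ℓ := 5) (by decide)

/-- No rational `2`-torsion abscissa on `[1,1,1,-11,-20]` (the route's `ht` binder). [cite: SilvermanAEC2009, III.2.3 (b)] -/
theorem not_hasRationalTwoTorsionX_n14539 [((⟨1, 1, 1, -11, -20⟩ : WeierstrassCurve ℤ).baseChange ℚ).IsElliptic] :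
    ∀ x : ℚ, ¬ HasRationalTwoTorsionX ((⟨1, 1, 1, -11, -20⟩ : WeierstrassCurve ℤ).baseChange ℚ) x := by
  intro x hx
  exact (O1.irr_two_iff_not_exists_addOrderOf_eq_two _).mp irr_two_n14539 (exists_point_addOrderOf_eq_two hx)

/-- `Δ_min = −14539`. [cite: SilvermanAEC2009, VII.1] -/
theorem minimalDiscriminantInt_n14539 [((⟨1, 1, 1, -11, -20⟩ : WeierstrassCurve ℤ).baseChange ℚ).IsGloballyMinimal] :
    ((⟨1, 1, 1, -11, -20⟩ : WeierstrassCurve ℤ).baseChange ℚ).minimalDiscriminantInt = -14539 := by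
  rw [Instances.minimalDiscriminantInt_baseChange_int, M14539_Δ]

/-- `Δ_min = −14539 ≡ 5 (mod 8)`: the curve is OFF the Kilford stratum (`2 = 𝔭₁𝔭₂` in `ℚ(β)`). [cite: Serre1973, Ch. II §3.3 Thm. 4] -/
theorem minimalDiscriminantInt_emod_eight_n14539 [((⟨1, 1, 1, -11, -20⟩ : WeierstrassCurve ℤ).baseChange ℚ).IsGloballyMinimal] :
    ((⟨1, 1, 1, -11, -20⟩ : WeierstrassCurve ℤ).baseChange ℚ).minimalDiscriminantInt % 8 = 5 := by
  rw [minimalDiscriminantInt_n14539]; decide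

/-- `Δ < 0` (one real root of the `2`-division cubic: `ℚ(β)` is a complex cubic field). [cite: SilvermanAEC2009, III.1] -/
theorem Δ_n14539_neg : ((⟨1, 1, 1, -11, -20⟩ : WeierstrassCurve ℤ).baseChange ℚ).Δ < 0 := by
  rw [baseChange_int_Δ, M14539_Δ]; norm_num

/-- **`θ := (-100 − 7u + u²)/16 ∈ ℚ(β)` (`u = 4β`) is a root of `f = X³ − 6X² + 16X + 7`** (one `linear_combination` against
`ψ_W(β) = 4β³ + 5β² − 42β − 79 = 0`; the multiplier is the exact quotient in `ℚ[β]`).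
[cite: LMFDB, number field 3.1.14539.1 (degree 3, discriminant −14539)] [cite: SilvermanAEC2009, III.1] -/
theorem aeval_theta_n14539 {β : AlgebraicClosure ℚ}
    (hβ : aeval β ((⟨1, 1, 1, -11, -20⟩ : WeierstrassCurve ℤ).baseChange ℚ).twoTorsionPolynomial.toPoly = 0) :
    aeval ((AdjoinSimple.gen ℚ β : ↥(IntermediateField.adjoin ℚ ({β} : Set (AlgebraicClosure ℚ)))) ^ 2
        - 7 / 4 * (AdjoinSimple.gen ℚ β : ↥(IntermediateField.adjoin ℚ ({β} : Set (AlgebraicClosure ℚ))))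
        - 25 / 4)
      (MonicCubic.poly (-6) (16) (7)) = 0 := by
  have hψ := psi_gen_eq_zero ((⟨1, 1, 1, -11, -20⟩ : WeierstrassCurve ℤ).baseChange ℚ) hβ
  rw [c14539_b.1, c14539_b.2.1, c14539_b.2.2] at hψ
  set g : ↥(IntermediateField.adjoin ℚ ({β} : Set (AlgebraicClosure ℚ))) := AdjoinSimple.gen ℚ β with hg
  simp only [MonicCubic.poly, map_add, map_mul, map_pow, aeval_X, eq_intCast, map_intCast]
  push_cast at hψ ⊢
  linear_combination ((1 / 4 : ↥(IntermediateField.adjoin ℚ ({β} : Set (AlgebraicClosure ℚ)))) * g ^ 3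
    + (-13 / 8 : ↥(IntermediateField.adjoin ℚ ({β} : Set (AlgebraicClosure ℚ)))) * g ^ 2
    + (49 / 64 : ↥(IntermediateField.adjoin ℚ ({β} : Set (AlgebraicClosure ℚ)))) * g
    + (463 / 64 : ↥(IntermediateField.adjoin ℚ ({β} : Set (AlgebraicClosure ℚ))))) * hψ

/-- `[ℚ(β) : ℚ] = 3` (`E[2]` of `[1,1,1,-11,-20]` is irreducible). [cite: SilvermanAEC2009, III.2.3 (b)] -/
theorem finrank_cubicField_n14539 {β : AlgebraicClosure ℚ}
    (hβ : aeval β ((⟨1, 1, 1, -11, -20⟩ : WeierstrassCurve ℤ).baseChange ℚ).twoTorsionPolynomial.toPoly = 0) :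
    finrank ℚ ↥(IntermediateField.adjoin ℚ ({β} : Set (AlgebraicClosure ℚ))) = 3 := by
  haveI := isElliptic_n14539
  exact AddKatoTwo.finrank_adjoin_root_twoTorsionPolynomial_eq_three _
    (AlignedTransportAtTwoSeed.irr_two_of_forall_not_hasRationalTwoTorsionX _ not_hasRationalTwoTorsionX_n14539) hβ

/-- **`d_{ℚ(β)} = −14539`**: `ℚ(β)` is the cubic field of discriminant `−14539` (att-p4's `CubicDisc14539.discr_eq` at the model `θ`).
[cite: LMFDB, number field 3.1.14539.1 (discriminant −14539)] -/
theorem discr_cubicField_n14539 {β : AlgebraicClosure ℚ}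
    (hβ : aeval β ((⟨1, 1, 1, -11, -20⟩ : WeierstrassCurve ℤ).baseChange ℚ).twoTorsionPolynomial.toPoly = 0) :
    (haveI : FiniteDimensional ℚ ↥(IntermediateField.adjoin ℚ ({β} : Set (AlgebraicClosure ℚ))) :=
        IntermediateField.adjoin.finiteDimensional ((AlgebraicClosure.isAlgebraic ℚ).isAlgebraic β).isIntegral;
      haveI : NumberField ↥(IntermediateField.adjoin ℚ ({β} : Set (AlgebraicClosure ℚ))) := NumberField.mk;
      NumberField.discr ↥(IntermediateField.adjoin ℚ ({β} : Set (AlgebraicClosure ℚ))) = -14539) := by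
  haveI : FiniteDimensional ℚ ↥(IntermediateField.adjoin ℚ ({β} : Set (AlgebraicClosure ℚ))) :=
    IntermediateField.adjoin.finiteDimensional ((AlgebraicClosure.isAlgebraic ℚ).isAlgebraic β).isIntegral
  haveI : NumberField ↥(IntermediateField.adjoin ℚ ({β} : Set (AlgebraicClosure ℚ))) := NumberField.mk
  exact CubicDisc14539.discr_eq (finrank_cubicField_n14539 hβ) (aeval_theta_n14539 hβ)

/-- ★ **THE CLASS NUMBER OF `ℚ(β)` IS ONE** (`β` any root in `ℚ̄` of the `2`-division cubic of `[1,1,1,-11,-20]`): `ℚ(β)` is the cubic field of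
discriminant `−14539`, and `h = 1` is the tree theorem `CubicDisc14539.classNumber_eq_one` (`𝓞 = ℤ[θ]`, Minkowski bound, every prime below it principal with an
explicit generator). [cite: LMFDB, number field 3.1.14539.1 (class number 1)] [cite: Marcus2018, Ch. 5, Thm. 37] -/
theorem classNumber_cubicField_n14539_eq_one {β : AlgebraicClosure ℚ}
    (hβ : aeval β ((⟨1, 1, 1, -11, -20⟩ : WeierstrassCurve ℤ).baseChange ℚ).twoTorsionPolynomial.toPoly = 0) :
    (haveI : FiniteDimensional ℚ ↥(IntermediateField.adjoin ℚ ({β} : Set (AlgebraicClosure ℚ))) :=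
        IntermediateField.adjoin.finiteDimensional ((AlgebraicClosure.isAlgebraic ℚ).isAlgebraic β).isIntegral;
      haveI : NumberField ↥(IntermediateField.adjoin ℚ ({β} : Set (AlgebraicClosure ℚ))) := NumberField.mk;
      classNumber ↥(IntermediateField.adjoin ℚ ({β} : Set (AlgebraicClosure ℚ))) = 1) := by
  haveI : FiniteDimensional ℚ ↥(IntermediateField.adjoin ℚ ({β} : Set (AlgebraicClosure ℚ))) :=
    IntermediateField.adjoin.finiteDimensional ((AlgebraicClosure.isAlgebraic ℚ).isAlgebraic β).isIntegral
  haveI : NumberField ↥(IntermediateField.adjoin ℚ ({β} : Set (AlgebraicClosure ℚ))) := NumberField.mk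
  exact CubicDisc14539.classNumber_eq_one (finrank_cubicField_n14539 hβ) (aeval_theta_n14539 hβ)

/-- ★ **`2 ∤ h(ℚ(β))`** — VERBATIM the displayed datum `hh` / `2 ∤ h_K` of the cell's class-group doors (att-p5 g29 Chevalley doors, att-p3 g41 layer-one
unit door, g42 depth door), now a theorem for this curve. [cite: LMFDB, number field 3.1.14539.1 (class number 1)] -/
theorem not_two_dvd_classNumber_cubicField_n14539 {β : AlgebraicClosure ℚ}
    (hβ : aeval β ((⟨1, 1, 1, -11, -20⟩ : WeierstrassCurve ℤ).baseChange ℚ).twoTorsionPolynomial.toPoly = 0) :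
    (haveI : FiniteDimensional ℚ ↥(IntermediateField.adjoin ℚ ({β} : Set (AlgebraicClosure ℚ))) :=
        IntermediateField.adjoin.finiteDimensional ((AlgebraicClosure.isAlgebraic ℚ).isAlgebraic β).isIntegral;
      haveI : NumberField ↥(IntermediateField.adjoin ℚ ({β} : Set (AlgebraicClosure ℚ))) := NumberField.mk;
      ¬ 2 ∣ classNumber ↥(IntermediateField.adjoin ℚ ({β} : Set (AlgebraicClosure ℚ)))) := by
  haveI : FiniteDimensional ℚ ↥(IntermediateField.adjoin ℚ ({β} : Set (AlgebraicClosure ℚ))) :=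
    IntermediateField.adjoin.finiteDimensional ((AlgebraicClosure.isAlgebraic ℚ).isAlgebraic β).isIntegral
  haveI : NumberField ↥(IntermediateField.adjoin ℚ ({β} : Set (AlgebraicClosure ℚ))) := NumberField.mk
  exact CubicDisc14539.not_two_dvd_classNumber (finrank_cubicField_n14539 hβ) (aeval_theta_n14539 hβ)

end Summit.BirchSwinnertonDyer.BirchSwinnertonDyer.Theorems.AlignedTransportAtTwoCubicDoorsDeadSubcellClassNumberG

end
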